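import Literature.Computability.Complexity.BPPErrorReductionStrong
import Literature.Computability.Complexity.UniformProbBlocks
import HarnessLib

/-!
# Crux `ArithStatLadder.IqThreeNotBPP` (stmt-QuantumAdvantage-14864)

Stub `stub_blockMissProb` of the line `Sketch`: the **product rule for fresh coin blocks**.

A uniform coin string `R ∈ {0,1}^{sℓ}` is read as `s` consecutive blocks of length `ℓ`
(block `j` is `(R ⇂ jℓ) ↾ ℓ`). The probability that every block avoids an event `G` is
`(1 - Pr_ℓ[G])^s`: counting over `{0,1}^{sℓ} ≃ ({0,1}^ℓ)^s` (`BPPAmp.blocksEquiv`, whose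
coordinate `j` is block `j`, `BPPAmp.ofFn_blocksEquiv`), the strings all of whose blocks miss `G`
correspond to the product set `Fintype.piFinset fun _ : Fin s => {a | ofFn a ∈ Gᶜ}` of
cardinality `(cnt ℓ Gᶜ)^s` (`Fintype.card_piFinset_const`), and `cnt ℓ Gᶜ / 2^ℓ = 1 - Pr_ℓ[G]`
(`uniformProb_compl`). Independence of disjoint coin blocks, Arora–Barak 2009, §A.2.
-/

set_option linter.dupNamespace false -- D-0017: single-problem summit ⇒ QuantumAdvantage.QuantumAdvantage by design

namespace Summit.QuantumAdvantage.QuantumAdvantage.Theorems.IqThreeNotBPP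

open _root_.Computability Literature.Computability.Complexity Finset

open scoped Classical

/-- **Counting the miss event through `blocksEquiv`**: the strings of length `sℓ` all of whose `s`
blocks of length `ℓ` avoid `G` are in bijection with the `s`-tuples of blocks in `Gᶜ`, so they
number `(cnt ℓ Gᶜ)^s`. [folklore] -/
theorem cnt_blockMiss_eq (s ℓ : ℕ) (G : Set (List Bool)) :
    cnt (s * ℓ) {R : List Bool | ∀ j < s, (R.drop (j * ℓ)).take ℓ ∉ G} = cnt ℓ Gᶜ ^ s := by
  rw [BPPAmp.cnt_eq_card_ofFn ℓ Gᶜ, ← Fintype.card_piFinset_const]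
  unfold cnt
  refine card_equiv (BPPAmp.blocksEquiv s ℓ) fun v => ?_
  simp only [mem_filter, mem_univ, true_and, Set.mem_setOf_eq, Fintype.mem_piFinset,
    BPPAmp.ofFn_blocksEquiv, BPPAmp.block, Set.mem_compl_iff]
  exact ⟨fun h j => h j j.is_lt, fun h j hj => h ⟨j, hj⟩⟩

/-- **Product rule for fresh coin blocks** (stub `stub_blockMissProb` of line `Sketch`): the
probability that all `s` consecutive blocks of length `ℓ` of a uniform string of length `sℓ`
avoid `G` is `(1 − Pr_ℓ[G])^s` (independence of disjoint coin blocks). [folklore] -/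
theorem stub_blockMissProb :
    ∀ (s ℓ : ℕ) (G : Set (List Bool)),
      uniformProb (s * ℓ) {R : List Bool | ∀ j < s, (R.drop (j * ℓ)).take ℓ ∉ G} =
        (1 - uniformProb ℓ G) ^ s := by
  intro s ℓ G
  rw [← uniformProb_compl, uniformProb_eq_cnt_div, uniformProb_eq_cnt_div, cnt_blockMiss_eq,
    Nat.cast_pow, div_pow, ← pow_mul']

end Summit.QuantumAdvantage.QuantumAdvantage.Theorems.IqThreeNotBPP
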